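import Summits.SmoothPoincare4.SmoothPoincare4.Theorems.ConvexBisectionAcyclicBisectionExistsChartTransition
import HarnessLib

/-!
# The sign rule at a crossing of two positively charted page curves
(wave 4, stretch brick Y4-7 = sub-lemma (v) SIGNS of the symmetry statement (R1)
`crossingNumber_symm` for the missing lemma `crossingNumber_eq_stdSymp` of node N1a of stub
`stub_modelsOnFibred_of_reach` = NF4, line `modp-braid-orbits`, crux
`ConvexBisection.AcyclicBisectionExists`, item stmt-SmoothPoincare4-10508; registered sub-goal
`helper_crossing_signs`)

Z6-REPORT §3 (R1)(v): let `φ`, `ψ` be two annulus charts of `page g c` (smooth, periodic, in the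
page, injective on the strip, positively oriented) and `φ (u₀, 0) = ψ (v₀, k)` a common point of the
core of `φ` with the level `k ∈ (−1, 1)` of `ψ`.  The transition maps of `…ChartTransition.lean`
in the two directions write

  `dΦ(u₀,0)(1,0) = γ · dΨ(v₀,k)(1,0) + δ · dΨ(v₀,k)(0,1)`,  `δ = d/du height ψ (φ (u, 0)) |_{u₀}`,
  `dΨ(v₀,k)(1,0) = α · dΦ(u₀,0)(1,0) + β · dΦ(u₀,0)(0,1)`,  `β = d/dv height φ (ψ (v, k)) |_{v₀}`,

and both frames are complex-positive (`orient_fderiv`), so the landed sign rule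
`crossing_sign_antisymm` (Z6-6) gives **`sign β = −sign δ`** (`helper_crossing_signs`): the curve
`v ↦ ψ (v, k)` crosses the chart `φ` upwards exactly when the core of `φ` crosses the chart `ψ`
downwards.  This is the local content of the antisymmetry `crossingNumber φ b = −crossingNumber ψ a`.
Everything is proved; no `sorry`.  References: B. Farb, D. Margalit, *A primer on mapping class
groups* (2012), §6.1 [FarbMargalit2012].
-/

noncomputable section

set_option linter.dupNamespace false

open scoped Manifold ContDiff Topology
open Set Function Filter
open Literature.Topology.FourManifolds Literature.Topology.FourManifolds.LefschetzBase

namespace Summit.SmoothPoincare4.SmoothPoincare4.Theorems.AcyclicBisectionExists.ModpBraidOrbits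

variable {g : ℕ} {c : ℂ} {φ ψ : ℝ × ℝ → Base g}

/-- **The velocity of one chart along a horizontal line, decomposed in the frame of the other**:
if `T` is a transition map from `φ` to `ψ` at `p₀ = (u₀, r₀)`, `q₀ = T p₀` (so that
`dΨ(q₀) ∘ dT(p₀) = dΦ(p₀)`), then `dΦ(p₀)(1,0) = γ dΨ(q₀)(1,0) + δ dΨ(q₀)(0,1)` with
`(γ, δ) = dT(p₀)(1,0)` and `δ = d/du (T (u, r₀)).2`. [folklore] -/
theorem fderiv_decomp_of_transition {T : ℝ × ℝ → ℝ × ℝ} {p₀ q₀ : ℝ × ℝ} (hTs : ContDiffAt ℝ ∞ T p₀)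
    (hD : (fderiv ℝ (fun q : ℝ × ℝ => (ψ q).1) q₀).comp (fderiv ℝ T p₀) = fderiv ℝ (fun p : ℝ × ℝ => (φ p).1) p₀) :
    fderiv ℝ (fun p : ℝ × ℝ => (φ p).1) p₀ ((1 : ℝ), (0 : ℝ)) =
      (fderiv ℝ T p₀ ((1 : ℝ), (0 : ℝ))).1 • fderiv ℝ (fun q : ℝ × ℝ => (ψ q).1) q₀ ((1 : ℝ), (0 : ℝ)) +
        (fderiv ℝ T p₀ ((1 : ℝ), (0 : ℝ))).2 • fderiv ℝ (fun q : ℝ × ℝ => (ψ q).1) q₀ ((0 : ℝ), (1 : ℝ)) ∧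
      deriv (fun u => (T (u, p₀.2)).2) p₀.1 = (fderiv ℝ T p₀ ((1 : ℝ), (0 : ℝ))).2 := by
  constructor
  · rw [← hD, ContinuousLinearMap.comp_apply]
    set w := fderiv ℝ T p₀ ((1 : ℝ), (0 : ℝ)) with hw
    conv_lhs => rw [show w = w.1 • ((1 : ℝ), (0 : ℝ)) + w.2 • ((0 : ℝ), (1 : ℝ)) by ext <;> simp]
    rw [map_add, map_smul, map_smul]
  · obtain ⟨a, b⟩ := p₀
    dsimp only
    have hTd : DifferentiableAt ℝ T (a, b) := hTs.differentiableAt (by simp)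
    have hline : HasDerivAt (fun u : ℝ => ((u, b) : ℝ × ℝ)) ((1 : ℝ), (0 : ℝ)) a :=
      (hasDerivAt_id' a).prodMk (hasDerivAt_const a b)
    have h := hTd.hasFDerivAt.comp_hasDerivAt a hline
    have h2 := (ContinuousLinearMap.snd ℝ ℝ ℝ).hasFDerivAt.comp_hasDerivAt a h
    exact h2.deriv

/-- **Sub-goal `helper_crossing_signs`** (Z6 §3 (R1)(v) SIGNS, a step of the symmetry statement for
node N1a of NF4): at a common point `φ (u₀, 0) = ψ (v₀, k)` (`k ∈ (−1,1)`) of two positively oriented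
annulus charts of `page g c`, the derivative `β` at `v₀` of the height of `v ↦ ψ (v, k)` in the chart
`φ` and the derivative `δ` at `u₀` of the height of the core `u ↦ φ (u, 0)` in the chart `ψ` have
OPPOSITE signs: `(0 < β ↔ δ < 0) ∧ (β < 0 ↔ 0 < δ) ∧ (β = 0 ↔ δ = 0)`. [cite: FarbMargalit2012, §6.1] -/
theorem helper_crossing_signs : ∀ (g : ℕ) (c : ℂ) (_hc : ‖c‖ = 1) (φ ψ : ℝ × ℝ → Literature.Topology.FourManifolds.LefschetzBase.Base g), ContMDiff 𝓘(ℝ, ℝ × ℝ) (𝓡∂ 4) ∞ φ → (∀ u r, φ (u + 1, r) = φ (u, r)) → (∀ p, φ p ∈ Literature.Topology.FourManifolds.LefschetzBase.page g c) → Set.InjOn φ (Set.Ico (0 : ℝ) 1 ×ˢ Set.Ioo (-1 : ℝ) 1) → (∀ u r, r ∈ Set.Ioo (-1 : ℝ) 1 → 0 < inner ℝ (deriv (fun r' => (φ (u, r')).1) r) (Literature.Topology.FourManifolds.LefschetzBase.cplxJ (deriv (fun u' => (φ (u', r)).1) u))) → ContMDiff 𝓘(ℝ, ℝ × ℝ)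 (𝓡∂ 4) ∞ ψ → (∀ u r, ψ (u + 1, r) = ψ (u, r)) → (∀ p, ψ p ∈ Literature.Topology.FourManifolds.LefschetzBase.page g c) → Set.InjOn ψ (Set.Ico (0 : ℝ) 1 ×ˢ Set.Ioo (-1 : ℝ) 1) → (∀ u r, r ∈ Set.Ioo (-1 : ℝ) 1 → 0 < inner ℝ (deriv (fun r' => (ψ (u, r')).1) r) (Literature.Topology.FourManifolds.LefschetzBase.cplxJ (deriv (fun u' => (ψ (u', r)).1) u))) → ∀ (u₀ v₀ k : ℝ), k ∈ Set.Ioo (-1 : ℝ) 1 → φ (u₀, 0) = ψ (v₀, k) → (0 < deriv (fun v => Summit.SmoothPoincare4.SmoothPoincare4.Theorems.AcyclicBisectionExists.ModpBraidOrbits.height φ (ψ (v, k))) v₀ ↔ deriv (fun u => Summit.SmoothPoincare4.SmoothPoincare4.Theorems.AcyclicBisectionExists.ModpBraidOrbits.height ψ (φ (u, 0))) u₀ < 0) ∧ (deriv (fun v => Summit.SmoothPoincare4.SmoothPoincare4.Theorems.AcyclicBisectionExists.ModpBraidOrbits.height φ (ψ (v, k))) v₀ < 0 ↔ 0 < deriv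 (fun u => Summit.SmoothPoincare4.SmoothPoincare4.Theorems.AcyclicBisectionExists.ModpBraidOrbits.height ψ (φ (u, 0))) u₀) ∧ (deriv (fun v => Summit.SmoothPoincare4.SmoothPoincare4.Theorems.AcyclicBisectionExists.ModpBraidOrbits.height φ (ψ (v, k))) v₀ = 0 ↔ deriv (fun u => Summit.SmoothPoincare4.SmoothPoincare4.Theorems.AcyclicBisectionExists.ModpBraidOrbits.height ψ (φ (u, 0))) u₀ = 0) := by
  intro g c hc φ ψ hφs hφ1 hφp hφi hφo hψs hψ1 hψp hψi hψo u₀ v₀ k hk h0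
  have h00 : (0 : ℝ) ∈ Ioo (-1 : ℝ) 1 := by norm_num
  -- transition from `φ` to `ψ` at `(u₀, 0) ↦ (v₀, k)`
  obtain ⟨T, hT0, hTs, hTev, hTD⟩ := exists_transition hc hφs hφp hψs hψ1 hψp hψi hψo (p₀ := (u₀, 0))
    (q₀ := (v₀, k)) hk h0
  -- transition from `ψ` to `φ` at `(v₀, k) ↦ (u₀, 0)`
  obtain ⟨T', hT'0, hT's, hT'ev, hT'D⟩ := exists_transition hc hψs hψp hφs hφ1 hφp hφi hφo (p₀ := (v₀, k))
    (q₀ := (u₀, 0)) h00 h0.symm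
  -- the heights are the second components of the transition maps
  have hδ : deriv (fun u => height ψ (φ (u, 0))) u₀ = (fderiv ℝ T (u₀, 0) ((1 : ℝ), (0 : ℝ))).2 := by
    rw [← (fderiv_decomp_of_transition (φ := φ) (ψ := ψ) (q₀ := (v₀, k)) hTs hTD).2]
    refine Filter.EventuallyEq.deriv_eq ?_
    have hcont : ContinuousAt (fun u : ℝ => ((u, (0 : ℝ)) : ℝ × ℝ)) u₀ := by fun_prop
    filter_upwards [hcont.eventually hTev] with u hu
    rw [← hu.1, show T (u, 0) = ((T (u, 0)).1, (T (u, 0)).2) from rfl]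
    exact height_of_lift hψ1 hψi hu.2
  have hβ : deriv (fun v => height φ (ψ (v, k))) v₀ = (fderiv ℝ T' (v₀, k) ((1 : ℝ), (0 : ℝ))).2 := by
    rw [← (fderiv_decomp_of_transition (φ := ψ) (ψ := φ) (q₀ := (u₀, 0)) hT's hT'D).2]
    refine Filter.EventuallyEq.deriv_eq ?_
    have hcont : ContinuousAt (fun v : ℝ => ((v, k) : ℝ × ℝ)) v₀ := by fun_prop
    filter_upwards [hcont.eventually hT'ev] with v hv
    rw [← hv.1, show T' (v, k) = ((T' (v, k)).1, (T' (v, k)).2) from rfl]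
    exact height_of_lift hφ1 hφi hv.2
  rw [hδ, hβ]
  exact crossing_sign_antisymm (orient_fderiv hφs hφo (u := u₀) h00) (orient_fderiv hψs hψo (u := v₀) hk)
    (fderiv_decomp_of_transition (φ := ψ) (ψ := φ) (q₀ := (u₀, 0)) hT's hT'D).1
    (fderiv_decomp_of_transition (φ := φ) (ψ := ψ) (q₀ := (v₀, k)) hTs hTD).1

end Summit.SmoothPoincare4.SmoothPoincare4.Theorems.AcyclicBisectionExists.ModpBraidOrbits

end
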